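import Summits.Ventures.PercRepro.C041SeedCoverBase
import Summits.Ventures.PercRepro.C041StarBoundsTwo
import Summits.Ventures.PercRepro.C041StarBoundsThree
import Summits.Ventures.PercRepro.C041StarBoundsFour
import Summits.Ventures.PercRepro.C041StarBoundsTiny
import Summits.Ventures.PercRepro.C041SeedCoverTinyB
import Summits.Ventures.PercRepro.C041SeedSlab452
import Summits.Ventures.PercRepro.C041SeedSlab423
import Summits.Ventures.PercRepro.C041SeedSlab424
import Summits.Ventures.PercRepro.C041SeedSlab425
import Summits.Ventures.PercRepro.C041SeedSlab426
import Summits.Ventures.PercRepro.C041SeedSlab447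
import Summits.Ventures.PercRepro.C041SeedSlab434
import Summits.Ventures.PercRepro.C041SeedSlab435
import Summits.Ventures.PercRepro.C041SeedSlab436
import Summits.Ventures.PercRepro.C041SeedSlab433

/-!
# THE TINY-LEAF REGION `A ≤ 1/20`, `B ≤ 1/2`, `P₁ ≤ 6/5` OF THE LAST SEED (mine-3, gen 65; C-041.md §21 (az))

The leaf count `n = m + 2` is the hidden parameter here: every leaf satisfies `a i² ≤ P₁ - 1 ≤ 1/5`, hence
`a i ≤ 0.4473` and `1 + (1 - a i)² ≥ 1.3054`, so `P₂ ≥ 1.3054 ^ n`; Cauchy–Schwarz with the Weierstrass bound gives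
`(1 - B)² ≤ n (P₁ - 1)`; and `B · 2 ^ n ≤ P₂`.  For `n = 2, …, 7` these are the hypotheses `hCS`, `hPOW`, `hLC` of the
cap-safe slab theorems `InCone_thetaTri_v1_slab452` (`n = 2`, cap `5/2`), `…slab423` (`n = 3`, cap `4`), `…slab424`
(`n = 4`, cap `8`), `…slab425` (`n = 5`, cap `16`), `…slab426` (`n = 6`, cap `32`), `…slab447` (`n = 7`, cap `7`,
no `hPOW`); for `n ≥ 8` the floor `P₂ ≥ 1.3054 ^ 8 ≥ 8.43` alone is used, in the slabs `…slab434` (`B ≤ 1/10`, with the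
prefactor `v 0 * v 0`), `…slab435` (`1/10 ≤ B ≤ 7/40`), `…slab436` (`7/40 ≤ B ≤ 1/4`), `…slab433` (`1/4 ≤ B ≤ 1/2`), cap `9`.  Where a star sits above a slab's cap its
`P₂` is lowered to the cap (`lower_hyps_capsafe` of `C041SeedCoverTinyB`).
-/

namespace PercRepro

namespace RelaxedTriangle

open TreeClosure

/-- Every leaf's square is at most `P₁ - 1`. -/
theorem tinyA_leaf_sq_le {m : ℕ} (a : Fin (m + 2) → ℝ) (i : Fin (m + 2)) :
    a i ^ 2 ≤ ∏ j, (1 + a j ^ 2) - 1 := by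
  have h1 : 1 ≤ ∏ j ∈ Finset.univ.erase i, (1 + a j ^ 2) :=
    Finset.one_le_prod (fun j _ => by nlinarith [sq_nonneg (a j)])
  have h2 := Finset.mul_prod_erase Finset.univ (fun j => 1 + a j ^ 2) (Finset.mem_univ i)
  have h3 : 0 ≤ a i ^ 2 := sq_nonneg _
  nlinarith [mul_le_mul_of_nonneg_left h1 (by positivity : (0 : ℝ) ≤ 1 + a i ^ 2)]

/-- `P₁ ≤ 6/5` bounds every leaf by `0.4473`. -/
theorem tinyA_leaf_le {m : ℕ} (a : Fin (m + 2) → ℝ)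
    (hP : ∏ j, (1 + a j ^ 2) ≤ (6 / 5 : ℝ)) (i : Fin (m + 2)) : a i ≤ (4473 / 10000 : ℝ) := by
  have h := tinyA_leaf_sq_le a i
  by_contra hcon
  have hcon' : (4473 / 10000 : ℝ) < a i := not_le.mp hcon
  have : (4473 / 10000 : ℝ) ^ 2 < a i ^ 2 := by gcongr
  norm_num at this
  linarith

/-- `P₁ ≤ 6/5` forces `P₂ ≥ 1.3054 ^ n` (`n = m + 2` leaves). -/
theorem tinyA_lc_pow_le {m : ℕ} (a : Fin (m + 2) → ℝ)
    (hP : ∏ j, (1 + a j ^ 2) ≤ (6 / 5 : ℝ)) : (13054 / 10000 : ℝ) ^ (m + 2) ≤ ∏ i, (1 + (1 - a i) ^ 2) := by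
  have h : (13054 / 10000 : ℝ) ^ (m + 2) = ∏ _i : Fin (m + 2), (13054 / 10000 : ℝ) := by
    rw [Finset.prod_const, Finset.card_univ, Fintype.card_fin]
  rw [h]
  apply Finset.prod_le_prod
  · intro i _; norm_num
  · intro i _
    have := tinyA_leaf_le a hP i
    nlinarith

/-- Cauchy–Schwarz with Weierstrass: `(1 - B)² ≤ n (P₁ - 1)`. -/
theorem tinyA_cs {m : ℕ} (a : Fin (m + 2) → ℝ) (ha : ∀ i, 0 ≤ a i ∧ a i ≤ 1) :
    (1 - ∏ i, (1 - a i)) ^ 2 ≤ ((m + 2 : ℕ) : ℝ) * (∏ i, (1 + a i ^ 2) - 1) := by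
  have hB1 : ∏ i, (1 - a i) ≤ 1 :=
    Finset.prod_le_one (fun i _ => by linarith [(ha i).2]) (fun i _ => by linarith [(ha i).1])
  have hs := one_sub_prod_one_sub_le_sum a ha
  have ht := sum_sq_le_prod_one_add_sq_sub_one_fin a
  have hcs := sq_sum_le_card_mul_sum_sq_fin a
  have e1 := pow_le_pow_left₀ (sub_nonneg.2 hB1) hs 2
  have hn : (0 : ℝ) ≤ ((m + 2 : ℕ) : ℝ) := by positivity
  nlinarith [mul_le_mul_of_nonneg_left ht hn]

/-- Every cap `c ≥ 5/2` satisfies the cap-safe lower star bounds on `A ∈ [0, 1]`, `B ∈ [0, 1/2]`, `P₁ ≥ 1`. -/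
theorem tinyA_cap_facts (P1 A B c : ℝ) (hc : (5 / 2 : ℝ) ≤ c) (hA0 : 0 ≤ A) (hA1 : A ≤ 1) (hB0 : 0 ≤ B)
    (hB1 : B ≤ (1 / 2 : ℝ)) (hP1a : (1 : ℝ) ≤ P1) :
    1 + B ^ 2 ≤ c ∧ 4 * B ≤ c ∧ 3 / 2 * (1 - A) ^ 2 ≤ P1 * (c - 1) ∧ (1 + B) ^ 2 ≤ c := by
  have hAq : (1 - A) ^ 2 ≤ 1 := by nlinarith [mul_nonneg hA0 (sub_nonneg.2 hA1)]
  refine ⟨?_, ?_, ?_, ?_⟩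
  · nlinarith [mul_nonneg hB0 (sub_nonneg.2 hB1)]
  · linarith
  · nlinarith [hAq, hP1a, hc]
  · nlinarith [mul_nonneg hB0 (sub_nonneg.2 hB1)]

/-- The last seed on the tiny-leaf region `A ≤ 1/20`, `B ≤ 1/2`, `P₁ ≤ 6/5`: `θ_△(v 1, V a) ∈ cone`. -/
theorem InCone_thetaTri_v1_V_tinyA {m : ℕ} (a : Fin (m + 2) → ℝ) (ha : ∀ i, 0 ≤ a i ∧ a i ≤ 1)
    (hA : ∏ i, a i ≤ (1 / 20 : ℝ)) (hB : ∏ i, (1 - a i) ≤ (1 / 2 : ℝ)) (hP : ∏ i, (1 + a i ^ 2) ≤ (6 / 5 : ℝ)) :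
    InCone (thetaTri (v 1) (V a)) := by
  obtain ⟨hA00, hA11⟩ := prod_unit_mem a ha
  have h1 := one_add_prod_sq_le a ha
  have h2 := one_add_prod_one_sub_sq_le a ha
  have h4A := four_mul_prod_le_prod_one_add_sq a ha
  have h4B := four_mul_prod_one_sub_le_prod a ha
  have hR := sharp_R a ha
  have hu1 := prod_one_add_sq_sq_mul_prod_one_sub_le_one a ha
  have hu2 := prod_one_add_one_sub_sq_sq_mul_prod_le_one a ha
  have hR2 := four_mul_prod_mul_prod_one_sub_le a ha
  have hB3 := prod_one_sub_le_sq_one_sub_prod a ha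
  have hAB1 := prod_add_prod_one_sub_le_one a ha
  have hS1 := sq_one_add_prod_le_prod_one_add_sq_leaf a ha
  have hS2 := sq_one_add_prod_one_sub_le_prod a ha
  have hLCm := tinyA_lc_pow_le a hP
  have hCSm := tinyA_cs a ha
  have hPOWm := prod_one_sub_mul_two_pow_le a ha
  have hB00 : 0 ≤ ∏ i, (1 - a i) := Finset.prod_nonneg (fun i _ => by linarith [(ha i).2])
  set P1 := ∏ i, (1 + a i ^ 2) with hP1d
  set P2 := ∏ i, (1 + (1 - a i) ^ 2) with hP2d
  set A := ∏ i, a i with hAd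
  set B := ∏ i, (1 - a i) with hBd
  have hA0 : (0 : ℝ) ≤ A := hA00
  have hB0 : (0 : ℝ) ≤ B := hB00
  have hP1a : (1 : ℝ) ≤ P1 := by nlinarith [sq_nonneg A]
  rcases Nat.lt_or_ge m 6 with hm | hm
  · rcases m with _ | _ | _ | _ | _ | _ | m
    · -- `n = 2`: slab 452, cap `5/2`
      have hCS : (1 - B) ^ 2 ≤ 2 * (P1 - 1) := by norm_num at hCSm; linarith
      have hPOW : 4 * B ≤ P2 := by norm_num at hPOWm; linarith
      have hLC : (17 / 10 : ℝ) ≤ P2 := by norm_num at hLCm; linarith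
      obtain ⟨c2, c4B, cR, cS2⟩ := tinyA_cap_facts P1 A B (5 / 2) le_rfl hA0 hA11 hB0 hB hP1a
      obtain ⟨l2, l4, lR, lS2, lu2⟩ :=
        lower_hyps_capsafe P1 P2 A B (5 / 2) hA0 (by norm_num) h2 h4B hR hS2 hu2 c2 c4B cR cS2
      exact InCone_thetaTri_v1_V_of_le a le_rfl (min_le_left _ _)
        (InCone_thetaTri_v1_slab452 P1 (min P2 (5 / 2 : ℝ)) A B hA0 hA hB0 hB hP1a hP (min_le_right _ _) h1 l2 h4A l4
          lR hu1 lu2 hR2 hB3 hAB1 hS1 lS2 hCS (le_min hLC (by norm_num)) (le_min hPOW (by linarith)))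
    · -- `n = 3`: slab 423, cap `4`
      have hCS : (1 - B) ^ 2 ≤ 3 * (P1 - 1) := by norm_num at hCSm; linarith
      have hPOW : 8 * B ≤ P2 := by norm_num at hPOWm; linarith
      have hLC : (111 / 50 : ℝ) ≤ P2 := by norm_num at hLCm; linarith
      obtain ⟨c2, c4B, cR, cS2⟩ := tinyA_cap_facts P1 A B 4 (by norm_num) hA0 hA11 hB0 hB hP1a
      obtain ⟨l2, l4, lR, lS2, lu2⟩ :=
        lower_hyps_capsafe P1 P2 A B 4 hA0 (by norm_num) h2 h4B hR hS2 hu2 c2 c4B cR cS2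
      exact InCone_thetaTri_v1_V_of_le a le_rfl (min_le_left _ _)
        (InCone_thetaTri_v1_slab423 P1 (min P2 (4 : ℝ)) A B hA0 hA hB0 hB hP1a hP (min_le_right _ _) h1 l2 h4A l4
          lR hu1 lu2 hR2 hB3 hAB1 hS1 lS2 hCS (le_min hPOW (by linarith)) (le_min hLC (by norm_num)))
    · -- `n = 4`: slab 424, cap `8`
      have hCS : (1 - B) ^ 2 ≤ 4 * (P1 - 1) := by norm_num at hCSm; linarith
      have hPOW : 16 * B ≤ P2 := by norm_num at hPOWm; linarith
      have hLC : (29 / 10 : ℝ) ≤ P2 := by norm_num at hLCm; linarith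
      obtain ⟨c2, c4B, cR, cS2⟩ := tinyA_cap_facts P1 A B 8 (by norm_num) hA0 hA11 hB0 hB hP1a
      obtain ⟨l2, l4, lR, lS2, lu2⟩ :=
        lower_hyps_capsafe P1 P2 A B 8 hA0 (by norm_num) h2 h4B hR hS2 hu2 c2 c4B cR cS2
      exact InCone_thetaTri_v1_V_of_le a le_rfl (min_le_left _ _)
        (InCone_thetaTri_v1_slab424 P1 (min P2 (8 : ℝ)) A B hA0 hA hB0 hB hP1a hP (min_le_right _ _) h1 l2 h4A l4
          lR hu1 lu2 hR2 hB3 hAB1 hS1 lS2 hCS (le_min hPOW (by linarith)) (le_min hLC (by norm_num)))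
    · -- `n = 5`: slab 425, cap `16`
      have hCS : (1 - B) ^ 2 ≤ 5 * (P1 - 1) := by norm_num at hCSm; linarith
      have hPOW : 32 * B ≤ P2 := by norm_num at hPOWm; linarith
      have hLC : (379 / 100 : ℝ) ≤ P2 := by norm_num at hLCm; linarith
      obtain ⟨c2, c4B, cR, cS2⟩ := tinyA_cap_facts P1 A B 16 (by norm_num) hA0 hA11 hB0 hB hP1a
      obtain ⟨l2, l4, lR, lS2, lu2⟩ :=
        lower_hyps_capsafe P1 P2 A B 16 hA0 (by norm_num) h2 h4B hR hS2 hu2 c2 c4B cR cS2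
      exact InCone_thetaTri_v1_V_of_le a le_rfl (min_le_left _ _)
        (InCone_thetaTri_v1_slab425 P1 (min P2 (16 : ℝ)) A B hA0 hA hB0 hB hP1a hP (min_le_right _ _) h1 l2 h4A l4
          lR hu1 lu2 hR2 hB3 hAB1 hS1 lS2 hCS (le_min hPOW (by linarith)) (le_min hLC (by norm_num)))
    · -- `n = 6`: slab 426, cap `32`
      have hCS : (1 - B) ^ 2 ≤ 6 * (P1 - 1) := by norm_num at hCSm; linarith
      have hPOW : 64 * B ≤ P2 := by norm_num at hPOWm; linarith
      have hLC : (247 / 50 : ℝ) ≤ P2 := by norm_num at hLCm; linarith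
      obtain ⟨c2, c4B, cR, cS2⟩ := tinyA_cap_facts P1 A B 32 (by norm_num) hA0 hA11 hB0 hB hP1a
      obtain ⟨l2, l4, lR, lS2, lu2⟩ :=
        lower_hyps_capsafe P1 P2 A B 32 hA0 (by norm_num) h2 h4B hR hS2 hu2 c2 c4B cR cS2
      exact InCone_thetaTri_v1_V_of_le a le_rfl (min_le_left _ _)
        (InCone_thetaTri_v1_slab426 P1 (min P2 (32 : ℝ)) A B hA0 hA hB0 hB hP1a hP (min_le_right _ _) h1 l2 h4A l4
          lR hu1 lu2 hR2 hB3 hAB1 hS1 lS2 hCS (le_min hPOW (by linarith)) (le_min hLC (by norm_num)))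
    · -- `n = 7`: slab 447, cap `7` (no `hPOW`)
      have hCS : (1 - B) ^ 2 ≤ 7 * (P1 - 1) := by norm_num at hCSm; linarith
      have hLC : (129 / 20 : ℝ) ≤ P2 := by norm_num at hLCm; linarith
      obtain ⟨c2, c4B, cR, cS2⟩ := tinyA_cap_facts P1 A B 7 (by norm_num) hA0 hA11 hB0 hB hP1a
      obtain ⟨l2, l4, lR, lS2, lu2⟩ :=
        lower_hyps_capsafe P1 P2 A B 7 hA0 (by norm_num) h2 h4B hR hS2 hu2 c2 c4B cR cS2
      exact InCone_thetaTri_v1_V_of_le a le_rfl (min_le_left _ _)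
        (InCone_thetaTri_v1_slab447 P1 (min P2 (7 : ℝ)) A B hA0 hA hB0 hB hP1a hP (min_le_right _ _) h1 l2 h4A l4
          lR hu1 lu2 hR2 hB3 hAB1 hS1 lS2 hCS (le_min hLC (by norm_num)))
    · omega
  · -- `n ≥ 8`: `P₂ ≥ 1.3054 ^ 8 ≥ 8.43`; slabs 434 / 435 / 436 / 433 by `B`, cap `9`
    have hLC : (843 / 100 : ℝ) ≤ P2 := by
      have h8 : (13054 / 10000 : ℝ) ^ 8 ≤ (13054 / 10000 : ℝ) ^ (m + 2) :=
        pow_le_pow_right₀ (by norm_num) (by omega)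
      have : (13054 / 10000 : ℝ) ^ 8 ≤ P2 := h8.trans hLCm
      norm_num at this
      linarith
    obtain ⟨c2, c4B, cR, cS2⟩ := tinyA_cap_facts P1 A B 9 (by norm_num) hA0 hA11 hB0 hB hP1a
    obtain ⟨l2, l4, lR, lS2, lu2⟩ :=
      lower_hyps_capsafe P1 P2 A B 9 hA0 (by norm_num) h2 h4B hR hS2 hu2 c2 c4B cR cS2
    rcases le_or_gt B (1 / 10 : ℝ) with hb1 | hb1
    · exact InCone_thetaTri_v1_V_of_le a le_rfl (min_le_left _ _)
        (InCone_thetaTri_v1_slab434 P1 (min P2 (9 : ℝ)) A B hA0 hA hB0 hb1 hP1a hP (min_le_right _ _) h1 l2 h4A l4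
          lR hu1 lu2 hR2 hB3 hAB1 hS1 lS2 (le_min hLC (by norm_num)))
    · rcases le_or_gt B (7 / 40 : ℝ) with hb2 | hb2
      · exact InCone_thetaTri_v1_V_of_le a le_rfl (min_le_left _ _)
          (InCone_thetaTri_v1_slab435 P1 (min P2 (9 : ℝ)) A B hA0 hA hb1.le hb2 hP1a hP (min_le_right _ _) h1 l2 h4A
            l4 lR hu1 lu2 hR2 hB3 hAB1 hS1 lS2 (le_min hLC (by norm_num)))
      · rcases le_or_gt B (1 / 4 : ℝ) with hb3 | hb3
        · exact InCone_thetaTri_v1_V_of_le a le_rfl (min_le_left _ _)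
            (InCone_thetaTri_v1_slab436 P1 (min P2 (9 : ℝ)) A B hA0 hA hb2.le hb3 hP1a hP (min_le_right _ _) h1 l2 h4A
              l4 lR hu1 lu2 hR2 hB3 hAB1 hS1 lS2 (le_min hLC (by norm_num)))
        · exact InCone_thetaTri_v1_V_of_le a le_rfl (min_le_left _ _)
            (InCone_thetaTri_v1_slab433 P1 (min P2 (9 : ℝ)) A B hA0 hA hb3.le hB hP1a hP (min_le_right _ _) h1 l2 h4A
              l4 lR hu1 lu2 hR2 hB3 hAB1 hS1 lS2 (le_min hLC (by norm_num)))

end RelaxedTriangle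

end PercRepro
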